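import Summits.QuantumFields.QCD.Theorems.PauliWegnerSeaFMClosureUnquenchedDefs
import Literature.MathematicalPhysics.QuantumLattice.TwistedFreeWilsonDirac

/-!
# Side witness, part 1: chiral-projector algebra and the abstract flow-kernel lemma

Crux `FMClosureUnquenched` (stmt-QuantumFields-11512), line `von-mises-circles`, registered sub-goal
`c1_sideWitness : SideWitness` (2nd conjunct of `stub_deterministic`).

The side witness is a diagonal `SU(3)` lattice gauge field built from a *flow* (a 2-in-2-out,
antiparallel-free sub-digraph of the nearest-neighbour graph of the side `A`); in the limit of an
infinite imaginary twist along the flow the row-scaled side matrix degenerates to the *flow matrix*,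
whose row `x` carries the chiral hopping projectors `P(ℓ) = ½(1 ∓ γ_μ)` of the two flow edges leaving
`x`.  This file proves the two facts about the projectors `P(μ, b)` (`b = false`: forward hop,
`½(1 - γ_μ)`; `b = true`: backward hop, `½(1 + γ_μ)`) that make the flow matrix injective:
distinct labels have ranges meeting trivially and kernels meeting trivially
(`proj_mulVec_eq_zero_of_add_eq_zero`, `eq_zero_of_proj_mulVec_eq_zero`), and the resulting abstract
kernel lemma `flow_kernel` (= registered `c1_sideWitness_aux1`).
-/

namespace Summit.QuantumFields.QCD.Theorems.VonMisesCirclesC1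

open Matrix Literature.MathematicalPhysics.QuantumLattice Literature.Probability.LatticeModels

/-! ## Chiral projectors labelled by (direction, orientation) -/

/-- The hopping projector of label `(μ, b)` in closed form: `½(1 + s γ_μ)`, `s = ±1`. -/
theorem proj_eq (μ : Fin 4) (b : Bool) :
    (if b then chiralProjPlus μ else chiralProjMinus μ) =
      (2 : ℂ)⁻¹ • (1 + (if b then (1 : ℂ) else -1) • euclideanGamma μ) := by
  cases b <;> simp [chiralProjPlus, chiralProjMinus, sub_eq_add_neg]

/-- `s² = 1` for the orientation sign. -/
theorem sgn_mul_self (b : Bool) :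
    (if b then (1 : ℂ) else -1) * (if b then (1 : ℂ) else -1) = 1 := by
  cases b <;> simp

/-- `γ_μ` acts as the sign `s` on the range of `P(μ, b)`. -/
theorem gamma_mulVec_proj_mulVec (μ : Fin 4) (b : Bool) (a : Fin 4 → ℂ) :
    euclideanGamma μ *ᵥ ((if b then chiralProjPlus μ else chiralProjMinus μ) *ᵥ a) =
      (if b then (1 : ℂ) else -1) • ((if b then chiralProjPlus μ else chiralProjMinus μ) *ᵥ a) := by
  rw [proj_eq, mulVec_mulVec, ← smul_mulVec]
  congr 1
  have key : (if b then (1 : ℂ) else -1) • ((2 : ℂ)⁻¹ • (1 + (if b then (1 : ℂ) else -1) •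
      euclideanGamma μ)) = (2 : ℂ)⁻¹ • (euclideanGamma μ + (if b then (1 : ℂ) else -1) •
        (1 : Matrix (Fin 4) (Fin 4) ℂ)) := by
    rw [smul_comm, smul_add, smul_smul, sgn_mul_self, one_smul, add_comm]
  rw [key, Matrix.mul_smul, Matrix.mul_add, Matrix.mul_one, Matrix.mul_smul, euclideanGamma_mul_self]

/-- A vector killed by `P(μ, b)` is a `-s` eigenvector of `γ_μ`. -/
theorem gamma_mulVec_of_proj_mulVec_eq_zero (μ : Fin 4) (b : Bool) (v : Fin 4 → ℂ)
    (h : (if b then chiralProjPlus μ else chiralProjMinus μ) *ᵥ v = 0) :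
    euclideanGamma μ *ᵥ v = (if !b then (1 : ℂ) else -1) • v := by
  rw [proj_eq, smul_mulVec, smul_eq_zero] at h
  rcases h with h | h
  · norm_num at h
  rw [add_mulVec, one_mulVec, smul_mulVec] at h
  -- `v + s γ v = 0`, hence `γ v = -s v`
  have h2 : (if b then (1 : ℂ) else -1) • (v + (if b then (1 : ℂ) else -1) • euclideanGamma μ *ᵥ v)
      = 0 := by rw [h, smul_zero]
  rw [smul_add, smul_smul, sgn_mul_self, one_smul] at h2
  have h3 : euclideanGamma μ *ᵥ v = -((if b then (1 : ℂ) else -1) • v) :=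
    eq_neg_of_add_eq_zero_right h2
  rw [h3, ← neg_smul]
  cases b <;> simp

/-- A common eigenvector of `γ_μ` (sign `s`) and `γ_ν` (sign `s'`) with `(μ, s) ≠ (ν, s')` vanishes. -/
theorem common_eigvec_eq_zero {μ ν : Fin 4} {b b' : Bool} (hne : (μ, b) ≠ (ν, b')) (w : Fin 4 → ℂ)
    (hμ : euclideanGamma μ *ᵥ w = (if b then (1 : ℂ) else -1) • w)
    (hν : euclideanGamma ν *ᵥ w = (if b' then (1 : ℂ) else -1) • w) : w = 0 := by
  by_cases hμν : μ = ν
  · subst hμν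
    have hbb : b ≠ b' := fun h => hne (by rw [h])
    have hdiff : ((if b then (1 : ℂ) else -1) - (if b' then (1 : ℂ) else -1)) • w = 0 := by
      rw [sub_smul, ← hμ, ← hν, sub_self]
    have hcoef : ((if b then (1 : ℂ) else -1) - (if b' then (1 : ℂ) else -1)) ≠ 0 := by
      clear hdiff hμ hν hne
      cases b <;> cases b' <;> (simp at hbb ⊢; try norm_num)
    exact (smul_eq_zero.1 hdiff).resolve_left hcoef
  · have hanti := euclideanGamma_mul_of_ne hμν
    have h1 : (euclideanGamma μ * euclideanGamma ν) *ᵥ w =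
        ((if b' then (1 : ℂ) else -1) * (if b then (1 : ℂ) else -1)) • w := by
      rw [← mulVec_mulVec, hν, mulVec_smul, hμ, smul_smul]
    have h2 : (euclideanGamma ν * euclideanGamma μ) *ᵥ w =
        ((if b then (1 : ℂ) else -1) * (if b' then (1 : ℂ) else -1)) • w := by
      rw [← mulVec_mulVec, hμ, mulVec_smul, hν, smul_smul]
    rw [hanti, neg_mulVec, h2, mul_comm] at h1
    -- `-(c • w) = c • w` with `c = ±1`
    have h3 : ((2 : ℂ) * ((if b' then (1 : ℂ) else -1) * (if b then (1 : ℂ) else -1))) • w = 0 := by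
      rw [mul_smul, two_smul]
      nth_rewrite 1 [← h1]
      rw [neg_add_cancel]
    have hcoef : (2 : ℂ) * ((if b' then (1 : ℂ) else -1) * (if b then (1 : ℂ) else -1)) ≠ 0 := by
      cases b <;> cases b' <;> norm_num
    exact (smul_eq_zero.1 h3).resolve_left hcoef

/-- **Kernels of distinct projectors meet trivially.** -/
theorem eq_zero_of_proj_mulVec_eq_zero {ℓ ℓ' : Fin 4 × Bool} (hne : ℓ ≠ ℓ') (v : Fin 4 → ℂ)
    (h : (if ℓ.2 then chiralProjPlus ℓ.1 else chiralProjMinus ℓ.1) *ᵥ v = 0)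
    (h' : (if ℓ'.2 then chiralProjPlus ℓ'.1 else chiralProjMinus ℓ'.1) *ᵥ v = 0) : v = 0 := by
  obtain ⟨μ, b⟩ := ℓ
  obtain ⟨ν, b'⟩ := ℓ'
  have hne' : (μ, !b) ≠ (ν, !b') := by
    intro h
    apply hne
    simp only [Prod.mk.injEq, Bool.not_inj_iff] at h
    rw [h.1, h.2]
  exact common_eigvec_eq_zero hne' v (gamma_mulVec_of_proj_mulVec_eq_zero μ b v h)
    (gamma_mulVec_of_proj_mulVec_eq_zero ν b' v h')

/-- **Ranges of distinct projectors meet trivially**: `P(ℓ) a + P(ℓ') c = 0` forces `P(ℓ) a = 0`. -/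
theorem proj_mulVec_eq_zero_of_add_eq_zero {ℓ ℓ' : Fin 4 × Bool} (hne : ℓ ≠ ℓ') (a c : Fin 4 → ℂ)
    (h : (if ℓ.2 then chiralProjPlus ℓ.1 else chiralProjMinus ℓ.1) *ᵥ a +
      (if ℓ'.2 then chiralProjPlus ℓ'.1 else chiralProjMinus ℓ'.1) *ᵥ c = 0) :
    (if ℓ.2 then chiralProjPlus ℓ.1 else chiralProjMinus ℓ.1) *ᵥ a = 0 := by
  obtain ⟨μ, b⟩ := ℓ
  obtain ⟨ν, b'⟩ := ℓ'
  set w := (if b then chiralProjPlus μ else chiralProjMinus μ) *ᵥ a with hw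
  have hw' : (if b' then chiralProjPlus ν else chiralProjMinus ν) *ᵥ c = -w :=
    (eq_neg_of_add_eq_zero_right h)
  refine common_eigvec_eq_zero hne w (gamma_mulVec_proj_mulVec μ b a) ?_
  have h2 := gamma_mulVec_proj_mulVec ν b' c
  rw [hw', mulVec_neg, smul_neg, neg_inj] at h2
  exact h2

/-! ## The abstract flow-kernel lemma -/

/-- **Flow-kernel lemma** (registered `c1_sideWitness_aux1`).  Let `A` be a finite set of sites
carrying a flow: two out-edges `x ↦ σ i x ∈ A` with distinct labels `d i x`, and for every `y ∈ A`
two in-edges from `π j y ∈ A` with distinct labels `e j y` (each `π j y` being the tail of a flow edge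
into `y` with that label).  If a family of spinors `v` satisfies the flow-row equations
`P(d 0 x) v(σ 0 x) + P(d 1 x) v(σ 1 x) = 0` for all `x ∈ A`, then `v = 0` on `A`. -/
theorem flow_kernel {ι : Type*} (A : Finset ι) (σ π : Fin 2 → ι → ι) (d e : Fin 2 → ι → Fin 4 × Bool)
    (hd : ∀ x ∈ A, d 0 x ≠ d 1 x)
    (hπ : ∀ y ∈ A, ∀ j, π j y ∈ A ∧ ∃ i, σ i (π j y) = y ∧ d i (π j y) = e j y)
    (he : ∀ y ∈ A, e 0 y ≠ e 1 y) (v : ι → Fin 4 → ℂ)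
    (hrow : ∀ x ∈ A,
      (if (d 0 x).2 then chiralProjPlus (d 0 x).1 else chiralProjMinus (d 0 x).1) *ᵥ v (σ 0 x) +
        (if (d 1 x).2 then chiralProjPlus (d 1 x).1 else chiralProjMinus (d 1 x).1) *ᵥ v (σ 1 x) = 0) :
    ∀ y ∈ A, v y = 0 := by
  -- each flow edge kills its own term
  have hterm : ∀ x ∈ A, ∀ i : Fin 2,
      (if (d i x).2 then chiralProjPlus (d i x).1 else chiralProjMinus (d i x).1) *ᵥ v (σ i x) = 0 := by
    intro x hx i
    have h0 := proj_mulVec_eq_zero_of_add_eq_zero (hd x hx) _ _ (hrow x hx)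
    fin_cases i
    · exact h0
    · have h1 := hrow x hx
      rw [h0, zero_add] at h1
      exact h1
  intro y hy
  have hin : ∀ j : Fin 2,
      (if (e j y).2 then chiralProjPlus (e j y).1 else chiralProjMinus (e j y).1) *ᵥ v y = 0 := by
    intro j
    obtain ⟨hπA, i, hσ, hdi⟩ := hπ y hy j
    have := hterm (π j y) hπA i
    rwa [hσ, hdi] at this
  exact eq_zero_of_proj_mulVec_eq_zero (he y hy) (v y) (hin 0) (hin 1)

/-- **Registered helper `c1_sideWitness_aux1` of crux stmt-QuantumFields-11512** (line `von-mises-circles`,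
sub-goal `c1_sideWitness`): the flow-kernel lemma on the four-torus. -/
theorem c1_sideWitness_aux1 : ∀ (N : ℕ) (A : Finset (TorusSite 4 N)) (σ π : Fin 2 → TorusSite 4 N → TorusSite 4 N) (d e : Fin 2 → TorusSite 4 N → Fin 4 × Bool), (∀ x ∈ A, d 0 x ≠ d 1 x) → (∀ y ∈ A, ∀ j, π j y ∈ A ∧ ∃ i, σ i (π j y) = y ∧ d i (π j y) = e j y) → (∀ y ∈ A, e 0 y ≠ e 1 y) → ∀ (v : TorusSite 4 N → Fin 4 → ℂ), (∀ x ∈ A, (if (d 0 x).2 then chiralProjPlus (d 0 x).1 else chiralProjMinus (d 0 x).1) *ᵥ v (σ 0 x) + (if (d 1 x).2 then chiralProjPlus (d 1 x).1 else chiralProjMinus (d 1 x).1) *ᵥ v (σ 1 x) = 0) → ∀ y ∈ A, v y = 0 :=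
  fun _ A σ π d e hd hπ he v hrow => flow_kernel A σ π d e hd hπ he v hrow

end Summit.QuantumFields.QCD.Theorems.VonMisesCirclesC1
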